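import Summits.KontsevichZagierPeriods.KontsevichZagierPeriods.Theorems.MzvKernelInKZ.Negative.Duality
import Literature.NumberTheory.Transcendental.MultipleZetaStuffle
import Literature.NumberTheory.Transcendental.MZVWordShuffle
import Literature.NumberTheory.Transcendental.KZProduct

/-!
# `MzvKernelInKZ` (stmt-KontsevichZagierPeriods-3914), line two-posets-interior-landen: vocabulary

Definitions (no named facts) and the realisation bookkeeping (registered stub `stub_realisation`)
for the LINE `two-posets-interior-landen` on
the crux `LinRedNormalForm.MzvKernelInKZ` (lead prover; skeleton
`Theorems/LinRedNormalFormMzvKernelInKZ.lean`, stubs `Theorems/MzvKernelInKZ/TwoPosets/*.lean`).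
The line presents the relations among the crux's generators `[Δ_w, q·∏ ω_ε]` (canonical form
`Negative.wordRep`) by a finite family of move chains with absolutely convergent rational
intermediates — finite double shuffle (shuffle half: dissection of a product of simplices;
stuffle half: cubical charts and three-term partial fractions), Hoffman's relation (order-polytope
dissection + the interior Landen identity `E′`), duality (`Negative.Duality`) — and per-weight
EXACT CERTIFICATES reducing every admissible word to Hoffman words modulo that family.

Contents: the bracket `zWord` / `zIdx` (a word representation as an element of `KZ.FormalRep`,
`0` on non-admissible letters, so that statements carry no admissibility proofs); the open unit
cube and the cubical pull-back `cubicalFun` of a word integrand along the monomial chart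
`tᵢ = x₀ x₁ ⋯ xᵢ`; the two integrands of the interior Landen identity; the statements
`CubicalChart`, `InteriorLanden`, `HoffmanDepthOneInKZ`, `HoffmanDeepInKZ`, `ShuffleProductInKZ`,
`StuffleProductInKZ` (the calculus half, one `Prop` per stub); coefficient vectors
`Vec N = (Fin N → Bool) → ℚ`, the relation vectors `fdsVec`, `hoffmanVec`, `dualVec` and the
per-weight certificate statement `EdsCertificate N` (the combinatorial half, decidable for each
`N`); `HoffmanIndependent` (the transcendence input, = Zagier's conjecture given Brown's theorem); the
realisation map `real N : Vec N → KZ.FormalRep ⧸ KZ.relations` and the descended scaling `scaleQ`.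

Sources: M. Kontsevich, D. Zagier, *Periods* (2001), §1.2 (the rules); M. E. Hoffman, *Multiple
harmonic series*, Pacific J. Math. 152 (1992), Thm 5.1 (Hoffman's relation) and *The algebra of
multiple harmonic series*, J. Algebra 194 (1997) (stuffle, Hoffman basis conjecture); K. Ihara,
M. Kaneko, D. Zagier, *Derivation and double shuffle relations for multiple zeta values*, Compos.
Math. 142 (2006), §1 (finite double shuffle + Hoffman's relation ⟺ extended double shuffle;
Conjecture 1: completeness); M. Kaneko, S. Yamamoto, *A new integral–series identity of multiple
zeta values and regularizations*, Selecta Math. 24 (2018) (2-posets); F. Brown, *Mixed Tate motives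
over ℤ*, Ann. of Math. 175 (2012), Thm 1.1 (Hoffman spanning). -/

noncomputable section

namespace Summit.KontsevichZagierPeriods.MzvKernelInKZ.TwoPosets

open Set MeasureTheory
open Literature.NumberTheory.Transcendental
open Summit.KontsevichZagierPeriods.MzvKernelInKZ.Negative

/-! ## Words, indices and their representations as elements of `KZ.FormalRep` -/

/-- The word of length `N` read off a list of letters (junk letter `false` beyond the list; for a
list of length `N` nothing is lost). [folklore] -/
def wordOf (N : ℕ) (L : List Bool) : Fin N → Bool := fun i => L.getD i false

/-- The binary word `0^{s₁-1} 1 ⋯ 0^{s_k-1} 1` of an index, read as a word of length `N` (used with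
`N = MZV.weight s`). [cite: Zagier1994, §9] -/
def bword (N : ℕ) (s : List ℕ) : Fin N → Bool := wordOf N (MZV.binaryWord s)

/-- The bracket of a word: the class `[Δ_N, q · ∏ ω_ε] ∈ KZ.FormalRep` of the canonical word
representation `Negative.wordRep ε q` when the letters are admissible, and `0` otherwise (a
non-admissible word carries no integrable representation, `Negative.not_integrableOn_wordFun`).
[cite: KontsevichZagier2001, §1.1] -/
def zWord (N : ℕ) (ε : Fin N → Bool) (q : ℚ) : KZ.FormalRep :=
  if h : Adm ε then KZ.of (wordRep ε q h) else 0

/-- The bracket `[ζ(s)]_q = [Δ_{|s|}, q · ω_s]` of an index (`0` if `s` is not admissible).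
[cite: KontsevichZagier2001, §1.1] -/
def zIdx (s : List ℕ) (q : ℚ) : KZ.FormalRep := zWord (MZV.weight s) (bword (MZV.weight s) s) q

/-! ## The open cube, cubical charts, the interior Landen integrands -/

/-- The open unit cube `(0,1)^n`. [folklore] -/
def cube (n : ℕ) : Set (Fin n → ℝ) := {x | ∀ i, 0 < x i ∧ x i < 1}

/-- Partial products `P_i(x) = x₀ x₁ ⋯ x_i` (the monomial chart `t_i = P_i(x)` maps the open cube
onto the open ordered simplex `1 > t₀ > ⋯ > t_{N-1} > 0`). [folklore] -/
def pprod {N : ℕ} (x : Fin N → ℝ) (i : Fin N) : ℝ := ∏ j ∈ Finset.univ.filter (fun j => j ≤ i), x j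

/-- The monomial ("cubical", "forest") chart `x ↦ (P₀(x), …, P_{N-1}(x))` of the simplex.
[folklore] -/
def cubicalMap (N : ℕ) (x : Fin N → ℝ) : Fin N → ℝ := fun i => pprod x i

/-- The cubical pull-back of the word integrand `q · ∏ᵢ ω_{εᵢ}(tᵢ)`: the word integrand at
`t = cubicalMap x` times the Jacobian `∏_j x_j^{N-1-j}` of the chart. For the word of an index
`s = (s₁,…,s_k)` this is the familiar `∏_{i<k} X₁⋯X_i / ∏_{i≤k} (1 - X₁⋯X_i)` in the block
products `X_i` (not simplified here). [folklore] -/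
def cubicalFun {N : ℕ} (ε : Fin N → Bool) (q : ℚ) (x : Fin N → ℝ) : ℝ :=
  wordFun ε q (cubicalMap N x) * ∏ j : Fin N, x j ^ (N - 1 - (j : ℕ))

/-- Left integrand of the interior Landen identity with `m` spectators, on `(0,1)^{m+2}` with
coordinates `v = x 0`, spectators `p_i = x (i+1)` (`i < m`), `r = x (m+1)`, modulus
`y = p₁ ⋯ p_m`: `v / ((1 - y v)(1 - v r))`. [cite: KanekoYamamoto2018, Thm 4.1] -/
def landenLeft (m : ℕ) (x : Fin (m + 2) → ℝ) : ℝ :=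
  x 0 / ((1 - (∏ i : Fin m, x i.succ.castSucc) * x 0) * (1 - x 0 * x (Fin.last (m + 1))))

/-- Right integrand of the interior Landen identity: `1 / ((1 - y v)(1 - y v r))`, same
coordinates. [cite: KanekoYamamoto2018, Thm 4.1] -/
def landenRight (m : ℕ) (x : Fin (m + 2) → ℝ) : ℝ :=
  1 / ((1 - (∏ i : Fin m, x i.succ.castSucc) * x 0) *
    (1 - (∏ i : Fin m, x i.succ.castSucc) * x 0 * x (Fin.last (m + 1))))

/-! ## The calculus half: one statement per stub -/

/-- **Cubical chart.** For admissible letters the cubical pull-back `cubicalFun ε q` is absolutely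
integrable on the open cube (transport of `Negative.integrableOn_wordFun` along `cubicalMap`), and
the word representation `[Δ_N, q ω_ε]` is KZ-equivalent to any representation on the open cube
with that integrand — one change-of-variables move along `cubicalMap` (rule 2), whose Jacobian
`∏_j x_j^{N-1-j}` is the determinant of a triangular matrix. -/
def CubicalChart : Prop :=
  ∀ (N : ℕ) (ε : Fin N → Bool) (hε : Adm ε) (q : ℚ),
    IntegrableOn (cubicalFun ε q) (cube N) volume ∧
    ∀ (r : KZ.IntegralRep N), r.domain = cube N → EqOn r.integrand (cubicalFun ε q) (cube N) →
      KZ.of (wordRep ε q hε) - KZ.of r ∈ KZ.relations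

/-- **Interior Landen identity `E′` with spectators.** For `m ≥ 1` spectators,
`[(0,1)^{m+2}, v/((1-yv)(1-vr))] ~ [(0,1)^{m+2}, 1/((1-yv)(1-yvr))]`, `y = p₁⋯p_m` (both fibres
equal `y⁻¹(Li₂ y + ½ log²(1-y))`): five moves — `s = r/v`, the fibrewise Möbius involution
`φ_y(t) = (1-t)/(1-yt)` on both fibre coordinates, `ρ = vr`, and the two positive partial
fractions `1/(r(1-yr)) = 1/r + y/(1-yr)`, `1/(v(1-yv)) = 1/v + y/(1-yv)` — all intermediates
absolutely convergent positive rational representations. -/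
def InteriorLanden : Prop :=
  ∀ (m : ℕ), 1 ≤ m → ∀ (r₁ r₂ : KZ.IntegralRep (m + 2)),
    r₁.domain = cube (m + 2) → EqOn r₁.integrand (landenLeft m) (cube (m + 2)) →
    r₂.domain = cube (m + 2) → EqOn r₂.integrand (landenRight m) (cube (m + 2)) →
      KZ.Equivalent r₁ r₂

/-- **Hoffman's relation in depth one inside the calculus** (= Euler's depth-2 sum formula
`ζ(k+1) = ∑_{j=1}^{k-1} ζ(k+1-j, j)`), for `k ≥ 3` (`k = 2` is duality `ζ(3) = ζ(2,1)`, one move,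
`Negative.cDual3_mem_relations`): `[ζ(k+1)] − ∑_{j<k-1} [ζ(k-j, j+1)] ∈ KZ.relations` (indexed as
the `s = (k)` instance of the tree's `hoffman_relation`).
Chain: the order polytope `{a₁<⋯<a_k, d<a_k}` dissects into `[ζ(k,1)] + ∑_j [ζ(k+1-j, j)]`
(rule 1a, `k` linear extensions) and, through its forest chart, `E′` (`y = p₁⋯p_{k-2}`), one
partial fraction and two cubical charts, into `[ζ(k,1)] + [ζ(k+1)]`. -/
def HoffmanDepthOneInKZ : Prop :=
  ∀ k : ℕ, 3 ≤ k →
    zIdx [k + 1] 1 - ∑ j ∈ Finset.range (k - 1), zIdx [k - j, j + 1] 1 ∈ KZ.relations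

/-- **Hoffman's relation inside the calculus, all depths** (Hoffman 1992, Thm 5.1, in the tree's
indexing of `hoffman_relation`): for admissible `s` of depth `≥ 2`,
`∑_l [ζ(s₁,…,s_l+1,…)] − ∑_l ∑_{j<s_l-1} [ζ(s₁,…,s_l−j, j+1,…)] ∈ KZ.relations`.
(Depth one is `HoffmanDepthOneInKZ`.) -/
def HoffmanDeepInKZ : Prop :=
  ∀ s : List ℕ, MZV.IsAdmissible s → 2 ≤ s.length →
    (∑ l : Fin s.length, zIdx (s.take l.1 ++ [s.get l + 1] ++ s.drop (l.1 + 1)) 1) -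
      (∑ l : Fin s.length, ∑ j ∈ Finset.range (s.get l - 1),
        zIdx (s.take l.1 ++ [s.get l - j, j + 1] ++ s.drop (l.1 + 1)) 1) ∈ KZ.relations

/-- **The shuffle product is a dissection.** For admissible words `ε`, `ε'`, the product
representation `[Δ_a, ω_ε] · [Δ_b, ω_{ε'}] = [Δ_a × Δ_b, ω_ε ⊗ ω_{ε'}]` (`KZ.of_mul_of`) differs by
relations from the sum over all shuffles `w ∈ ε ш ε'` of `[Δ_{a+b}, ω_w]`: rule 1a (the shuffle
cells cover `Δ_a × Δ_b` up to the null set of ties) and coordinate permutations (rule 2). -/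
def ShuffleProductInKZ : Prop :=
  ∀ (a b : ℕ) (ε : Fin a → Bool) (ε' : Fin b → Bool) (hε : Adm ε) (hε' : Adm ε'), 0 < a → 0 < b →
    KZ.of (wordRep ε 1 hε) * KZ.of (wordRep ε' 1 hε') -
      ((MZV.shuffleWord (List.ofFn ε) (List.ofFn ε')).map fun w => zWord (a + b) (wordOf (a + b) w) 1).sum
        ∈ KZ.relations

/-- **The stuffle product is a partial-fraction regrouping in cubical charts.** For non-empty
admissible indices `s`, `t`, the product representation differs by relations from
`∑_{u ∈ s ∗ t} [ζ(u)]` (`MZV.stuffle`): cubical charts on both factors (rule 2), the three-term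
identity `1/((1-A)(1-B)) = A/((1-A)(1-AB)) + B/((1-B)(1-AB)) + 1/(1-AB)` applied recursively on the
smallest summation indices (rule 1b, all terms positive), coordinate permutations and cubical
charts back (rule 2). -/
def StuffleProductInKZ : Prop :=
  ∀ (s t : List ℕ) (hs : MZV.IsAdmissible s) (ht : MZV.IsAdmissible t), s ≠ [] → t ≠ [] →
    zIdx s 1 * zIdx t 1 - ((MZV.stuffle s t).map fun u => zIdx u 1).sum ∈ KZ.relations

/-! ## The combinatorial half: coefficient vectors and per-weight certificates -/

/-- Rational coefficient vectors on the words of length `N`. [folklore] -/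
abbrev Vec (N : ℕ) : Type := (Fin N → Bool) → ℚ

/-- The unit vector of a word. [folklore] -/
def unitVec (N : ℕ) (ε : Fin N → Bool) : Vec N := Pi.single ε 1

/-- The sum of the unit vectors of a list of words (with multiplicity). [folklore] -/
def listVec (N : ℕ) (L : List (Fin N → Bool)) : Vec N := (L.map (unitVec N)).sum

/-- The finite double shuffle vector of the pair `(s, t)` read in weight `N`:
`∑_{w ∈ ω_s ш ω_t} e_w − ∑_{u ∈ s ∗ t} e_u`. [cite: IharaKanekoZagier2006, §1] -/
def fdsVec (N : ℕ) (s t : List ℕ) : Vec N :=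
  listVec N ((MZV.shuffleWord (MZV.binaryWord s) (MZV.binaryWord t)).map (wordOf N)) -
    listVec N ((MZV.stuffle s t).map (bword N))

/-- Hoffman's relation vector of an admissible index `s` read in weight `N = |s| + 1`, indexed
exactly as the tree's `hoffman_relation`. [cite: Hoffman1992, Theorem 5.1] -/
def hoffmanVec (N : ℕ) (s : List ℕ) : Vec N :=
  (∑ l : Fin s.length, unitVec N (bword N (s.take l.1 ++ [s.get l + 1] ++ s.drop (l.1 + 1)))) -
    ∑ l : Fin s.length, ∑ j ∈ Finset.range (s.get l - 1),
      unitVec N (bword N (s.take l.1 ++ [s.get l - j, j + 1] ++ s.drop (l.1 + 1)))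

/-- The duality vector `e_ε − e_{ε†}` (`Negative.dualWord`). [cite: Zagier1994, §9] -/
def dualVec (N : ℕ) (ε : Fin N → Bool) : Vec N := unitVec N ε - unitVec N (dualWord ε)

/-- **EDS certificate in weight `N`**: every admissible word of length `N` is, as a coefficient
vector, a rational combination of unit vectors of Hoffman indices of weight `N` plus a rational
combination of finite-double-shuffle vectors (pairs of non-empty admissible indices of total
weight `N`), Hoffman relation vectors (admissible indices of weight `N − 1`) and duality vectors
(admissible words) — with explicit coefficient lists, so that each instance is decidable. For all
`N` this is the completeness of extended double shuffle (Ihara–Kaneko–Zagier 2006, Conjecture 1,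
with Zagier's dimension conjecture; checked by exact rank far beyond the weights used here). -/
def EdsCertificate (N : ℕ) : Prop :=
  ∀ ε : Fin N → Bool, Adm ε →
    ∃ (H : List (List ℕ × ℚ)) (F : List ((List ℕ × List ℕ) × ℚ)) (D : List (List ℕ × ℚ))
      (K : List ((Fin N → Bool) × ℚ)),
      (∀ p ∈ H, MZV.IsHoffman p.1 ∧ MZV.weight p.1 = N) ∧
      (∀ p ∈ F, MZV.IsAdmissible p.1.1 ∧ MZV.IsAdmissible p.1.2 ∧ p.1.1 ≠ [] ∧ p.1.2 ≠ [] ∧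
        MZV.weight p.1.1 + MZV.weight p.1.2 = N) ∧
      (∀ p ∈ D, MZV.IsAdmissible p.1 ∧ MZV.weight p.1 + 1 = N) ∧
      (∀ p ∈ K, Adm p.1) ∧
      unitVec N ε - (H.map fun p => p.2 • unitVec N (bword N p.1)).sum =
        (F.map fun p => p.2 • fdsVec N p.1.1 p.1.2).sum +
          (D.map fun p => p.2 • hoffmanVec N p.1).sum + (K.map fun p => p.2 • dualVec N p.1).sum

/-! ## The transcendence input -/

/-- **Hoffman independence**: the real Hoffman values `ζ(s)`, `s ∈ {2,3}^×` (all weights, the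
empty index giving `ζ(∅) = 1`), are `ℚ`-linearly independent. OPEN: it is the conjunction of
Zagier's dimension conjecture and the weight-grading conjecture given Brown's theorem
(`ZagierConjecture ∧ hoffmanSpan_eq_mzvSpace → HoffmanIndependent`, proved in the skeleton); its
weight-5 instance already says `ζ(5) ∉ ℚ·ζ(2)ζ(3)`. Used only as a hypothesis. -/
def HoffmanIndependent : Prop :=
  LinearIndependent ℚ fun s : {s : List ℕ // MZV.IsHoffman s} => multipleZeta s.1

/-! ## Realisation modulo moves -/

/-- Rational rescaling on the group of formal periods modulo moves `KZ.FormalRep ⧸ KZ.relations`,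
descended from the scaling endomorphism `KZ.scale q` (which preserves every move set,
`KZ.scale_mem_relations`). [cite: KontsevichZagier2001, §1.2] -/
def scaleQ (q : ℚ) : KZ.FormalRep ⧸ KZ.relations →+ KZ.FormalRep ⧸ KZ.relations :=
  QuotientAddGroup.map KZ.relations KZ.relations (KZ.scale (q : ℝ) (isAlgebraic_ratCast q))
    fun _ hc => KZ.scale_mem_relations (q : ℝ) (isAlgebraic_ratCast q) hc

/-- **Realisation** of a coefficient vector on the words of length `N` as a formal period modulo
moves: `v ↦ ∑_ε class of [Δ_N, v(ε) · ω_ε]` (non-admissible words realise to `0`). Additive, and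
compatible with rational rescaling through `scaleQ` (integrand additivity; proved in the
skeleton); a certificate identity among vectors therefore becomes an identity among classes once
each relation vector realises to `0` — which is what the move-chain stubs say. [folklore] -/
def real (N : ℕ) (v : Vec N) : KZ.FormalRep ⧸ KZ.relations :=
  ∑ ε : Fin N → Bool, (QuotientAddGroup.mk (zWord N ε (v ε)) : KZ.FormalRep ⧸ KZ.relations)

/-! ## Derived statements -/

/-- Compatibility of the realisation map with the additive and `ℚ`-scaling structure (integrand
additivity and `KZ.scale` bookkeeping; the lead's first helper, landed together with the Defs). -/
def RealisationCompat : Prop :=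
  (∀ (N : ℕ) (v w : Vec N), real N (v + w) = real N v + real N w) ∧
  (∀ (N : ℕ) (q : ℚ) (v : Vec N), real N (q • v) = scaleQ q (real N v)) ∧
  (∀ (N : ℕ) (q a : ℚ) (ε : Fin N → Bool),
    scaleQ q (QuotientAddGroup.mk (zWord N ε a)) = QuotientAddGroup.mk (zWord N ε (q * a))) ∧
  (∀ (N : ℕ) (ε : Fin N → Bool), real N (unitVec N ε) = QuotientAddGroup.mk (zWord N ε 1))

/-- Completeness of the certificate family in every weight (conjectural for all `N`: with Zagier's
dimension conjecture it is Ihara–Kaneko–Zagier 2006, Conjecture 1 — extended double shuffle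
generates all relations; decidable and checked by exact rank for each small `N`). -/
def EdsComplete : Prop := ∀ N : ℕ, EdsCertificate N

/-- The certificate-realisation TRANSFER (lead's glue, v0 registered as a stub while being proved):
realisation compatibilities + the move-chain families + completeness + Hoffman independence give
the crux, through the all-weights transfer engine (independent values + spanning inside the
calculus ⇒ kernel ⊆ relations). -/
def TransferGlue : Prop :=
  RealisationCompat → CubicalChart → InteriorLanden → HoffmanDepthOneInKZ → ShuffleProductInKZ →
    StuffleProductInKZ → HoffmanDeepInKZ → EdsComplete → HoffmanIndependent →
      Summit.KontsevichZagierPeriods.KontsevichZagierPeriods.Theses.LinRedNormalForm.MzvKernelInKZ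


/-! ## Realisation bookkeeping (the registered stub `stub_realisation`) -/

section Realisation

variable {N : ℕ}

/-- The bracket of a word at coefficient `0` is a relation (zero integrand, or `0`). -/
theorem zWord_zero_mem_relations (ε : Fin N → Bool) : zWord N ε 0 ∈ KZ.relations := by
  unfold zWord
  split_ifs with h
  · exact of_wordRep_zero_mem_relations ε h
  · exact zero_mem _

/-- Additivity of the bracket in the coefficient, modulo relations (integrand additivity). -/
theorem zWord_add_sub_mem_relations (ε : Fin N → Bool) (a b : ℚ) :
    zWord N ε (a + b) - zWord N ε a - zWord N ε b ∈ KZ.relations := by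
  unfold zWord
  split_ifs with h
  · exact of_wordRep_add ε a b h
  · simp

/-- The class of the bracket is additive in the coefficient. -/
theorem mk_zWord_add (ε : Fin N → Bool) (a b : ℚ) :
    (QuotientAddGroup.mk (zWord N ε (a + b)) : KZ.FormalRep ⧸ KZ.relations) =
      QuotientAddGroup.mk (zWord N ε a) + QuotientAddGroup.mk (zWord N ε b) := by
  rw [← QuotientAddGroup.mk_add, QuotientAddGroup.eq_iff_sub_mem, ← sub_sub]
  exact zWord_add_sub_mem_relations ε a b

/-- The class of the bracket at coefficient `0` vanishes. -/
theorem mk_zWord_zero (ε : Fin N → Bool) :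
    (QuotientAddGroup.mk (zWord N ε 0) : KZ.FormalRep ⧸ KZ.relations) = 0 :=
  (QuotientAddGroup.eq_zero_iff _).mpr (zWord_zero_mem_relations ε)

/-- `scaleQ` on a class is the class of the scaled element. -/
theorem scaleQ_mk (q : ℚ) (c : KZ.FormalRep) :
    scaleQ q (QuotientAddGroup.mk c) =
      QuotientAddGroup.mk (KZ.scale (q : ℝ) (isAlgebraic_ratCast q) c) :=
  rfl

/-- Rational rescaling of a bracket is the bracket with rescaled coefficient, modulo relations
(`KZ.scale` multiplies integrands; no formal division is used). -/
theorem scaleQ_mk_zWord (q a : ℚ) (ε : Fin N → Bool) :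
    scaleQ q (QuotientAddGroup.mk (zWord N ε a)) = QuotientAddGroup.mk (zWord N ε (q * a)) := by
  rw [scaleQ_mk]
  unfold zWord
  split_ifs with h
  · rw [KZ.scale_of, QuotientAddGroup.eq_iff_sub_mem]
    exact of_sub_of_mem_relations_of_eqOn rfl fun t _ => by
      simp only [KZ.IntegralRep.integrand_constMul, wordRep_integrand, wordFun, Rat.cast_mul]
      ring
  · simp

/-- The realisation map is additive. -/
theorem real_add (v w : Vec N) : real N (v + w) = real N v + real N w := by
  simp only [real, Pi.add_apply, mk_zWord_add, Finset.sum_add_distrib]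

/-- The realisation map commutes with rational rescaling through `scaleQ`. -/
theorem real_smul (q : ℚ) (v : Vec N) : real N (q • v) = scaleQ q (real N v) := by
  simp only [real, map_sum, Pi.smul_apply, smul_eq_mul, scaleQ_mk_zWord]

/-- The realisation of a unit vector is the class of the corresponding bracket. -/
theorem real_unitVec (ε : Fin N → Bool) :
    real N (unitVec N ε) = QuotientAddGroup.mk (zWord N ε 1) := by
  classical
  unfold real unitVec
  rw [Finset.sum_eq_single ε]
  · rw [Pi.single_eq_same]
  · intro ε' _ hne
    rw [Pi.single_eq_of_ne hne, mk_zWord_zero]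
  · intro h
    exact absurd (Finset.mem_univ ε) h

/-- **Registered stub `stub_realisation`**: the realisation map is additive, `ℚ`-compatible
through `scaleQ`, rescales brackets coefficientwise, and sends unit vectors to brackets. -/
theorem stub_realisation : RealisationCompat :=
  ⟨fun _ v w => real_add v w, fun _ q v => real_smul q v, fun _ q a ε => scaleQ_mk_zWord q a ε,
    fun _ ε => real_unitVec ε⟩

end Realisation

end Summit.KontsevichZagierPeriods.MzvKernelInKZ.TwoPosets
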